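import Literature.NumberTheory.LFunctions.Zhang2022.Section3Lemma32Flat
import Literature.NumberTheory.LFunctions.Zhang2022.Section3SigmaSplitting
import Literature.NumberTheory.LFunctions.RealCharacterPartialSums
import HarnessLib

/-!
# Zhang (2022) §3: the input `E = ∑_{D⁴<n≤D⁸} ς(n)²/n ≪ 𝓛^{-2007}` of Lemma 3.6 WITHOUT
# subconvexity (ALT-1, variant A11), kernel-checked

Topic `Literature/NumberTheory/LFunctions/Zhang2022` (Landau–Siegel autopsy tree; verdict-neutral).
Y. Zhang, *Discrete mean estimates and the Landau–Siegel zero*, arXiv:2211.02515v1 — **an unrefereed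
manuscript, a claimed result under adjudication** — §3, Lemma 3.6, whose proof consumes
`E := ∑_{D⁴ < n ≤ D⁸} ς(n)²/n` with `ς = (ν ∗ υ)` truncated at `D⁴` (`ν = 1 ∗ χ`, `υ = μ ∗ μχ`), bounded
in the manuscript through Lemma 3.2 (`ν²τ₂²`, eight `L`-factors: needs a subconvex bound for
`L(s,χ)`, the cell's flag F7). The cell's ALT-1 report (§4, A11) replaces this by

* the ELEMENTARY reduction `E ≤ 4(1 + log D⁴)⁸ · V_ν`, `V_ν = ∑_{D⁴<n≤D⁸} τ(n)ν(n)²/n`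
  (`Section3SigmaSplitting.sum_sigma_sq_div_le_source_log_pow`, PROVED there for any real
  completely multiplicative `χ` with `|χ| ≤ 1`), and
* the ANALYTIC four-factor moment bound "Lemma 3.2♭" `V_ν ≪ 𝓛^{-2015}` under (A)
  (`Section3Lemma32Flat.lemma_3_2_flat`, PROVED).

This file joins the two halves: with the tree's restriction `DirichletAbel.reChar χ : n ↦ re χ(n)`
of a quadratic Dirichlet character to a real arithmetic function (`RealCharacterPartialSums.lean`:
`reChar_mul`, `reChar_one`, `abs_reChar_le_one` are the hypotheses of the elementary reduction) and
the identification `nuOf (reChar χ) n² = |ν_χ(n)|²` (`nuOf_reChar_sq_eq`), it concludes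

  **`lemma_3_6_input`**: there is an absolute `C` with
  `∑_{D⁴ < n ≤ D⁸} ς(n)²/n ≤ C (log D)^{-2007}` for every `D` with `log D ≥ 3` and every PRIMITIVE
  `χ` mod `D` with `χ² = 1` satisfying (A) `‖L(1,χ)‖ ≤ (log D)^{-2022}` — the printed exponent
  `2007` of the manuscript's Lemma 3.2/3.6 input, obtained with NO subconvexity input.

Verdict-neutral for the autopsy (R8): the located gap of the manuscript is at (8.24), downstream of
§3 and independent of every analytic input; no statement about Theorems 1–2 is made or implied.

## References

* Y. Zhang, arXiv:2211.02515 (2022), §3, Lemmas 3.2, 3.6. [cite: Zhang2022LandauSiegel, §3, Lemma 3.6]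
-/

noncomputable section

open ArithmeticFunction Finset

namespace Literature.NumberTheory.LFunctions.Zhang2022.Lemma36Input

open Literature.NumberTheory.LFunctions.Zhang2022 (sigmaTrunc nuOf upsilonOf
  sum_sigma_sq_div_le_source_log_pow)
open Literature.NumberTheory.LFunctions.Zhang2022.Lemma31 (divisorSumChar_im_eq_zero)
open Literature.NumberTheory.LFunctions.Zhang2022.Lemma32Flat (lemma_3_2_flat)
open Literature.NumberTheory.LFunctions.DirichletAbel (reChar reChar_apply reChar_zero reChar_mul
  reChar_one abs_reChar_le_one)

variable {D : ℕ} (χ : DirichletCharacter ℂ D)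

/-! ### The real restriction of a quadratic character and `ν` -/

/-- `reChar χ` is completely multiplicative on all of `ℕ` (`χ² = 1`; the tree's `reChar_mul` off `0`,
and `reChar χ 0 = 0`). [folklore] -/
theorem reChar_mul_all (hχ : χ ^ 2 = 1) (m n : ℕ) : reChar χ (m * n) = reChar χ m * reChar χ n := by
  rcases eq_or_ne m 0 with rfl | hm
  · rw [zero_mul, reChar_zero, zero_mul]
  rcases eq_or_ne n 0 with rfl | hn
  · rw [mul_zero, reChar_zero, mul_zero]
  exact reChar_mul χ hχ hm hn

/-- `nuOf (reChar χ) n = re ν_χ(n)` (`ν_χ(n) = ∑_{d∣n} χ(d)` = `divisorSumChar χ n`). [folklore] -/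
theorem nuOf_reChar_eq (n : ℕ) : nuOf (reChar χ) n = (divisorSumChar χ n).re := by
  rw [nuOf, coe_zeta_mul_apply, divisorSumChar_apply, Complex.re_sum]
  refine sum_congr rfl fun d hd => ?_
  exact reChar_apply χ (Nat.pos_of_mem_divisors hd).ne'

/-- `nuOf (reChar χ) n² = |ν_χ(n)|²` for `χ² = 1` (`ν_χ(n)` is real). [folklore] -/
theorem nuOf_reChar_sq_eq (hχ : χ ^ 2 = 1) (n : ℕ) :
    nuOf (reChar χ) n ^ 2 = ‖divisorSumChar χ n‖ ^ 2 := by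
  rw [nuOf_reChar_eq, Complex.sq_norm, Complex.normSq_apply, divisorSumChar_im_eq_zero χ hχ]
  ring

/-! ### The input of Lemma 3.6 -/

/-- **The input of Zhang's Lemma 3.6 without subconvexity (ALT-1 §4, A11), kernel-checked**: there is
an absolute constant `C` such that for every `D` with `log D ≥ 3` and every PRIMITIVE Dirichlet
character `χ` mod `D` with `χ² = 1` satisfying (A) `‖L(1,χ)‖ ≤ (log D)^{-2022}`,
`E = ∑_{D⁴ < n ≤ D⁸} ς(n)²/n ≤ C (log D)^{-2007}`, where
`ς(n) = ∑_{n = lm, l, m ≤ D⁴} ν(l)υ(m)` (`ν = 1 ∗ χ`, `υ = μ ∗ μχ`; `sigmaTrunc (nuOf χ) (upsilonOf χ) D⁴`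
of `Section3SigmaSplitting.lean`). [cite: Zhang2022LandauSiegel, §3, Lemma 3.2 + proof of Lemma 3.6
(the bound for ∑ ς(n)²/n); exponent 2007 as printed, via the cell's variant A11] -/
theorem lemma_3_6_input : ∃ C : ℝ, ∀ (D : ℕ) [NeZero D] (χ : DirichletCharacter ℂ D),
    χ.IsPrimitive → χ ^ 2 = 1 → 3 ≤ Real.log D →
    ‖χ.LFunction 1‖ ≤ 1 / Real.log D ^ 2022 →
      ∑ n ∈ Ioc (D ^ 4) (D ^ 4 * D ^ 4),
        sigmaTrunc (nuOf (reChar χ)) (upsilonOf (reChar χ)) (D ^ 4) n ^ 2 / n ≤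
          C / Real.log D ^ 2007 := by
  obtain ⟨C₀, hC₀⟩ := lemma_3_2_flat
  refine ⟨4 * 5 ^ 8 * max C₀ 0, ?_⟩
  intro D _ χ hprim hχ2 hL hA
  set Lg : ℝ := Real.log D with hLdef
  have hL1 : 1 ≤ Lg := by linarith
  have hL0 : 0 < Lg := by linarith
  have hD0 : D ≠ 0 := by
    rintro rfl; simp [hLdef] at hL; linarith
  have hDpos : (0 : ℝ) < D := by exact_mod_cast Nat.pos_of_ne_zero hD0
  have hY : 1 ≤ D ^ 4 := Nat.one_le_pow _ _ (Nat.pos_of_ne_zero hD0)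
  -- the elementary reduction
  have hred := sum_sigma_sq_div_le_source_log_pow (reChar χ) (reChar_mul_all χ hχ2) (reChar_one χ)
    (abs_reChar_le_one χ) hY
  -- the analytic input (Lemma 3.2♭) on `D⁴ < n ≤ D⁸`
  have hN : ((D ^ 4 * D ^ 4 : ℕ) : ℝ) ≤ (D : ℝ) ^ 8 := le_of_eq (by push_cast; ring)
  have hV := hC₀ D χ hprim hχ2 hL hA (D ^ 4 * D ^ 4) hN
  have hVeq : ∑ n ∈ Ioc (D ^ 4) (D ^ 4 * D ^ 4), (n.divisors.card : ℝ) * nuOf (reChar χ) n ^ 2 / n =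
      ∑ n ∈ Ioc (D ^ 4) (D ^ 4 * D ^ 4), ‖divisorSumChar χ n‖ ^ 2 * (n.divisors.card : ℝ) / n := by
    refine sum_congr rfl fun n _ => ?_
    rw [nuOf_reChar_sq_eq χ hχ2]; ring
  rw [hVeq] at hred
  rw [← hLdef] at hV
  have hV' : ∑ n ∈ Ioc (D ^ 4) (D ^ 4 * D ^ 4), ‖divisorSumChar χ n‖ ^ 2 * (n.divisors.card : ℝ) / n ≤
      max C₀ 0 / Lg ^ 2015 :=
    hV.trans (div_le_div_of_nonneg_right (le_max_left _ _) (by positivity))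
  -- the logarithmic factor `(1 + log D⁴)⁸ ≤ 5⁸ 𝓛⁸`
  have hlog : (1 + Real.log ((D ^ 4 : ℕ) : ℝ)) ^ 8 ≤ 5 ^ 8 * Lg ^ 8 := by
    have e : Real.log ((D ^ 4 : ℕ) : ℝ) = 4 * Lg := by
      rw [Nat.cast_pow, Real.log_pow]; push_cast; rw [hLdef]
    rw [e]
    calc (1 + 4 * Lg) ^ 8 ≤ (5 * Lg) ^ 8 := pow_le_pow_left₀ (by positivity) (by linarith) 8
      _ = 5 ^ 8 * Lg ^ 8 := by ring
  have hmax : 0 ≤ max C₀ 0 := le_max_right _ _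
  have hS0 : 0 ≤ ∑ n ∈ Ioc (D ^ 4) (D ^ 4 * D ^ 4),
      ‖divisorSumChar χ n‖ ^ 2 * (n.divisors.card : ℝ) / n :=
    sum_nonneg fun n _ => by positivity
  have step2 : 4 * (1 + Real.log ((D ^ 4 : ℕ) : ℝ)) ^ 8 *
      ∑ n ∈ Ioc (D ^ 4) (D ^ 4 * D ^ 4), ‖divisorSumChar χ n‖ ^ 2 * (n.divisors.card : ℝ) / n ≤
      4 * (5 ^ 8 * Lg ^ 8) * (max C₀ 0 / Lg ^ 2015) :=
    mul_le_mul (mul_le_mul_of_nonneg_left hlog (by norm_num)) hV' hS0 (by positivity)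
  have e3 : 4 * (5 ^ 8 * Lg ^ 8) * (max C₀ 0 / Lg ^ 2015) = 4 * 5 ^ 8 * max C₀ 0 / Lg ^ 2007 := by
    have : Lg ^ 2015 = Lg ^ 8 * Lg ^ 2007 := by rw [← pow_add]
    rw [this]
    field_simp
  exact hred.trans (step2.trans e3.le)

/-- The same with the range written `D⁴ < n ≤ D⁸`. [cite: Zhang2022LandauSiegel, §3, Lemma 3.6] -/
theorem lemma_3_6_input' : ∃ C : ℝ, ∀ (D : ℕ) [NeZero D] (χ : DirichletCharacter ℂ D),
    χ.IsPrimitive → χ ^ 2 = 1 → 3 ≤ Real.log D →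
    ‖χ.LFunction 1‖ ≤ 1 / Real.log D ^ 2022 →
      ∑ n ∈ Ioc (D ^ 4) (D ^ 8),
        sigmaTrunc (nuOf (reChar χ)) (upsilonOf (reChar χ)) (D ^ 4) n ^ 2 / n ≤
          C / Real.log D ^ 2007 := by
  obtain ⟨C, hC⟩ := lemma_3_6_input
  refine ⟨C, fun D _ χ hprim hχ2 hL hA => ?_⟩
  have e : D ^ 8 = D ^ 4 * D ^ 4 := by rw [← pow_add]
  rw [e]
  exact hC D χ hprim hχ2 hL hA

end Literature.NumberTheory.LFunctions.Zhang2022.Lemma36Input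

end
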